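import Mathlib
import Summits.CriticalPhenomena.Ising3DConformalLimit.Theses.HyperoctahedralRP

/-!
# Sketch — crux ideas for `LimitRotationInvariant` (item stmt-CriticalPhenomena-1980), ideator 3

First lemmas of two crux-idea cards (they only need to ELABORATE here; nothing is proved):

* card `laplacian-rp-round-light-cone`: `LatticeLaplacianRP`, `ContinuumLatticeConeRP`,
  `ContinuumLaplacianRP`, `RoundConeFromLatticeCone`, `LatticeToContinuumCone`;
* card `fourfold-carlson-boost`: `rot3`, `signedPerm`, `IsHyperoctahedralInvariant`,
  `FourfoldCarlson`, `FourfoldToFull`, `OneSpinKallenLehmann`.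
-/

noncomputable section

open scoped BigOperators
open Filter Topology MeasureTheory

namespace Summit.CriticalPhenomena.Ising3DConformalLimit.Cruxes.LimitRotationInvariant.Sketch

open Literature.Probability.LatticeModels

local notation "E3" => EuclideanSpace ℝ (Fin 3)

/-- Reflection in the coordinate plane `x 0 = 0` (the `e₀` site mirror, continuum version). -/
def refl0 (x : E3) : E3 := WithLp.toLp 2 ![-(x 0), x 1, x 2]

/-- Rotation by the angle `θ` about the `e₂`-axis (acts on coordinates `0, 1`). -/
def rot3 (θ : ℝ) (x : E3) : E3 :=
  WithLp.toLp 2 ![Real.cos θ * x 0 - Real.sin θ * x 1, Real.sin θ * x 0 + Real.cos θ * x 1, x 2]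

/-- The signed permutation `x ↦ (ε_j · x_{σ j})_j`, an element of the hyperoctahedral group
`B₃ = O_h` (all 48 arise this way). -/
def signedPerm (σ : Equiv.Perm (Fin 3)) (ε : Fin 3 → Bool) (x : E3) : E3 :=
  WithLp.toLp 2 (fun j => (if ε j then (1:ℝ) else -1) * x (σ j))

/-- Hyperoctahedral (`O_h`) invariance of a correlation family on `ℝ³` (the lattice symmetry
that every pointwise scaling limit of `criticalCorr 3` inherits). -/
def IsHyperoctahedralInvariant (S : CorrFamily 3) : Prop :=
  ∀ (n : ℕ) (σ : Equiv.Perm (Fin 3)) (ε : Fin 3 → Bool) (x : Fin n → E3),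
    S n (fun i => signedPerm σ ε (x i)) = S n x

/-! ### Card `laplacian-rp-round-light-cone` -/

/-- **LΔRP (lattice Laplacian reflection positivity; conjecture, the lever).** For the critical
plus-state correlators `G = criticalCorr 3` on `ℤ³`, the `e₀` site mirror `θ` and every step
`s ≥ 1`: for finitely many lattice configurations `x^a` inside `{x₀ > s}` (each injective) and
real coefficients `c_a`,
`Σ_{a,b} c_a c_b Σ_μ [G(θx^a ⊔ (x^b + s e_μ)) + G(θx^a ⊔ (x^b − s e_μ)) − 2 G(θx^a ⊔ x^b)] ≥ 0`,
i.e. in the transfer-matrix picture `2cosh(sH) − 2 ≥ Σ_{i=1,2} (2 − U_i^s − U_i^{-s})`: the joint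
spectrum of (transfer matrix, layer translations) lies in the lattice light cone
`cosh E − 1 ≥ Σ_i (1 − cos p_i)`, whose small-momentum shadow is the ROUND cone `E ≥ |p|`. -/
def LatticeLaplacianRP : Prop :=
  ∀ (s : ℕ), 1 ≤ s → ∀ (m : ℕ) (k : Fin m → ℕ) (x : (a : Fin m) → Fin (k a) → Site 3)
    (c : Fin m → ℝ), (∀ a, Function.Injective (x a)) → (∀ a i, (s : ℤ) < x a i 0) →
    0 ≤ ∑ a, ∑ b, c a * c b * ∑ μ : Fin 3,
      (criticalCorr 3 (k a + k b)
          (Fin.append (fun i => Function.update (x a i) 0 (-(x a i 0)))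
            (fun i => x b i + Pi.single μ (s : ℤ)))
        + criticalCorr 3 (k a + k b)
          (Fin.append (fun i => Function.update (x a i) 0 (-(x a i 0)))
            (fun i => x b i - Pi.single μ (s : ℤ)))
        - 2 * criticalCorr 3 (k a + k b)
          (Fin.append (fun i => Function.update (x a i) 0 (-(x a i 0))) (x b)))

/-- Continuum shadow of `LatticeLaplacianRP` at finite step `h > 0` for a correlation family `S`:
the same second-difference reflection positivity with the continuum mirror `refl0`. -/
def ContinuumLatticeConeRP (S : CorrFamily 3) : Prop :=
  ∀ (h : ℝ), 0 < h → ∀ (m : ℕ) (k : Fin m → ℕ) (X : (a : Fin m) → Fin (k a) → E3)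
    (c : Fin m → ℝ), (∀ a, Function.Injective (X a)) → (∀ a i, h < X a i 0) →
    0 ≤ ∑ a, ∑ b, c a * c b * ∑ μ : Fin 3,
      (S (k a + k b) (Fin.append (fun i => refl0 (X a i))
          (fun i => X b i + h • EuclideanSpace.single μ (1:ℝ)))
        + S (k a + k b) (Fin.append (fun i => refl0 (X a i))
          (fun i => X b i - h • EuclideanSpace.single μ (1:ℝ)))
        - 2 * S (k a + k b) (Fin.append (fun i => refl0 (X a i)) (X b)))

/-- **ΔRP (continuum Laplacian reflection positivity)**: the infinitesimal form — the OS form of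
the LAPLACIAN (in the rigid displacement `y` of the ket cluster) of `S(θX ⊔ (Y + y))` at `y = 0`
is positive semidefinite, stated through second differences so that no differentiability is
presupposed. In the `e₀` Osterwalder–Schrader picture this is `H² − P₁² − P₂² ≥ 0`, i.e. (with
`H ≥ 0`) the round spectral cone `H ≥ |P_⊥|` on ALL sectors. -/
def ContinuumLaplacianRP (S : CorrFamily 3) : Prop :=
  ∀ (m : ℕ) (k : Fin m → ℕ) (X : (a : Fin m) → Fin (k a) → E3) (c : Fin m → ℝ),
    (∀ a, Function.Injective (X a)) → (∀ a i, 0 < X a i 0) →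
    ∀ ε : ℝ, 0 < ε → ∃ h₀ : ℝ, 0 < h₀ ∧ ∀ h : ℝ, 0 < h → h < h₀ →
      -ε * h ^ 2 ≤ ∑ a, ∑ b, c a * c b * ∑ μ : Fin 3,
        (S (k a + k b) (Fin.append (fun i => refl0 (X a i))
            (fun i => X b i + h • EuclideanSpace.single μ (1:ℝ)))
          + S (k a + k b) (Fin.append (fun i => refl0 (X a i))
            (fun i => X b i - h • EuclideanSpace.single μ (1:ℝ)))
          - 2 * S (k a + k b) (Fin.append (fun i => refl0 (X a i)) (X b)))

/-- Elementary: a point that satisfies the lattice light-cone inequality at arbitrarily small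
scales lies in the ROUND cone. (Expand `cosh (δE) − 1 = δ²E²/2 + O(δ⁴)` and
`Σ (1 − cos (δ pᵢ)) = δ²|p|²/2 + O(δ⁴)`.) -/
def RoundConeFromLatticeCone : Prop :=
  ∀ (E : ℝ) (p : Fin 2 → ℝ), 0 ≤ E →
    (∃ δ : ℕ → ℝ, (∀ k, 0 < δ k) ∧ Tendsto δ atTop (𝓝 0) ∧
      ∀ k, ∑ i, (1 - Real.cos (δ k * p i)) ≤ Real.cosh (δ k * E) - 1) →
    Real.sqrt (∑ i, p i ^ 2) ≤ E

/-- Passage to the limit (support, provable): a pointwise scaling limit of the critical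
correlators inherits the finite-step cone positivity from `LatticeLaplacianRP`
(`⌊x/δ⌋ + s e_μ = ⌊(x + sδ e_μ)/δ⌋` exactly, and `sδ → h`). -/
def LatticeToContinuumCone : Prop :=
  LatticeLaplacianRP → ∀ (ρ : ℝ → ℝ) (S : CorrFamily 3), (∀ δ ∈ Set.Ioc (0:ℝ) 1, 0 < ρ δ) →
    HasPointwiseScalingLimit (criticalCorr 3) ρ S → (∀ n z, z ∉ NonCoincident 3 n → S n z = 0) →
    (∀ n, ContinuousOn (S n) (NonCoincident 3 n)) → ContinuumLatticeConeRP S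

/-! ### Card `fourfold-carlson-boost` -/

/-- **Fourfold Carlson lemma** (pure complex analysis, provable): an entire `π/2`-periodic
function of exponential type `< 4` in the imaginary direction is constant — its Fourier series
only has modes `e^{4ikz}`, and `|c_{4k}| ≤ C e^{(τ − 4|k|)|χ|}` for every `χ`. -/
def FourfoldCarlson : Prop :=
  ∀ (F : ℂ → ℂ), Differentiable ℂ F → (∀ z, F (z + ((Real.pi / 2 : ℝ) : ℂ)) = F z) →
    (∃ C τ : ℝ, τ < 4 ∧ ∀ z, ‖F z‖ ≤ C * Real.exp (τ * |z.im|)) → ∀ z w, F z = F w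

/-- **From fourfold to full rotations** (support, provable): an `O_h`-invariant family,
normalised off `NonCoincident`, whose angular functions `θ ↦ S n (R_θ x)` (rotation about one
lattice axis) extend to entire functions of type `< 4`, is `O(3)`-invariant: `FourfoldCarlson`
makes every angular function constant; conjugating by `O_h` gives all rotations about the other
two axes; Euler angles generate `SO(3)` and `−1 ∈ O_h` gives `O(3)`. -/
def FourfoldToFull : Prop :=
  ∀ S : CorrFamily 3, IsHyperoctahedralInvariant S →
    (∀ n z, z ∉ NonCoincident 3 n → S n z = 0) →
    (∀ (n : ℕ) (x : Fin n → E3), x ∈ NonCoincident 3 n → ∃ F : ℂ → ℂ, Differentiable ℂ F ∧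
      (∃ C τ : ℝ, τ < 4 ∧ ∀ z, ‖F z‖ ≤ C * Real.exp (τ * |z.im|)) ∧
      ∀ θ : ℝ, F (θ : ℂ) = ((S n (fun i => rot3 θ (x i)) : ℝ) : ℂ)) →
    IsRotationInvariant S

/-- **One-spin Källén–Lehmann superposition** (the entry point of hypothesis (A) = `HRP2Rigidity`
into the n-point problem; provable, a Gamma-integral): the round power kernel that (A) forces on
the two-point function is a POSITIVE superposition of Yukawa kernels `e^{-m r}/r`,
`‖x‖^{-2Δ} = Γ(2Δ−1)⁻¹ ∫₀^∞ m^{2Δ−2} e^{-m‖x‖}/‖x‖ dm` for `1/2 < Δ`; each Yukawa kernel has the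
Lorentz-invariant one-directional spectral measure `δ(E² − p² − m²)`, so the one-spin OS sector
`H_σ ≅ L²(V₊, ν_Δ)` carries unitary boosts and a round little group in every lattice picture. -/
def OneSpinKallenLehmann : Prop :=
  ∀ (Δ : ℝ), 1/2 < Δ → ∀ x : E3, x ≠ 0 →
    ‖x‖ ^ (-(2 * Δ)) =
      (Real.Gamma (2 * Δ - 1))⁻¹ *
        ∫ m in Set.Ioi (0:ℝ), m ^ (2 * Δ - 2) * (Real.exp (-(m * ‖x‖)) / ‖x‖)

/-- How the two cards compose for the crux (shape only; the cards' stubs are the content):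
(A) ⇒ round one-spin sector; `LatticeLaplacianRP` ⇒ `ContinuumLaplacianRP` ⇒ round cone on all
sectors ⇒ boost-entire angular functions of type `< 4` ⇒ `FourfoldToFull` ⇒ the crux. -/
def CardsComposeShape : Prop :=
  FourfoldCarlson → FourfoldToFull → LatticeToContinuumCone → LatticeLaplacianRP →
    Summit.CriticalPhenomena.Ising3DConformalLimit.Theses.HyperoctahedralRP.LimitRotationInvariant

end Summit.CriticalPhenomena.Ising3DConformalLimit.Cruxes.LimitRotationInvariant.Sketch

end
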